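import Literature.Topology.FourManifolds.SeamTubeNoncompact
import Literature.Topology.FourManifolds.InteriorLift
import Literature.Topology.FourManifolds.InteriorDiffeoExtension
import HarnessLib

/-!
# A product neighbourhood of an interior seam in a manifold with boundary

Topic `Literature/Topology/FourManifolds` (infrastructure for the uniqueness of cobordism
attachments `W ∪_ψ X`, Milnor, *Lectures on the h-cobordism theorem* (1965), Thm. 1.4,
uniqueness half, used by the fact seat of
`Literature.Barriers.SmoothPoincare4.akbulutRuberman2016_relativelyExotic`).  Everything here
is PROVED; no definitions, no named facts.

Let `V` be a Hausdorff second countable `(n+1)`-manifold WITH boundary and let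
`j₁ : Q₁ → V`, `j₂ : Q₂ → V` be smooth embeddings of two `(n+1)`-manifolds with boundary, with
values in the interior of `V`, covering the interior of `V`, and meeting exactly along
`∂Q₁ ≡_φ ∂Q₂` (`j₁ a = j₂ c ↔ a = incl z ∧ c = incl (φ z)` for boundary data `b₁`, `b₂` and a
bijection `φ`), the common image being a compact *interior seam* `S = j₁ (∂Q₁)`.  Examples: a
cobordism attachment `V = W ∪_ψ X` (`Q₁ = W`, `Q₂ = X - N`), a composite cobordism `Y = X ∪_N X′`
(`Q₁ = X - M`, `Q₂ = X′ - P`).  The theorem `exists_interior_seam_tube` provides a **seam tube**: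
a jointly smooth `K : ∂Q₁ × ℝ → V` with `K (z, 0) = j₁ (incl z)`, which on `∂Q₁ × (-ε, ε)` is a
diffeomorphism onto an open set `T` (smooth inverse `Kinv` on `T`), and which reads the two
pieces as the two sides: `K (z, t) ∈ range j₁ ↔ 0 ≤ t`, `K (z, t) ∈ range j₂ ↔ t ≤ 0`.

Proof: the interior `V° = InteriorManifold (𝓡∂ (n + 1)) V` is a manifold without boundary
(`InteriorManifold.lean`) into which `j₁`, `j₂` lift as smooth embeddings
(`Manifold.IsSmoothEmbedding.interiorLift`, `InteriorLift.lean`), forming a gluing datum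
`BoundaryGluingData b₁ b₂ φ V°` in the sense of `BoundaryGluingData.lean`; `V°` is Hausdorff,
second countable and locally compact, hence σ-compact, and the seam is compact, so the seam tube
of `SeamTubeNoncompact.lean` (`BoundaryGluingData.nonempty_seamTube_of_sigmaCompact`) exists; it
is pushed down to `V` along `val` (inverse via the retraction `InteriorManifold.toInterior`).
Hirsch (1976), Ch. 8 §1, proof of Thm. 1.9; Bröcker–Jänich (1982), (13.8).

## References

* M. W. Hirsch, *Differential Topology*, GTM 33 (1976), Ch. 8 §1, Thm. 1.9. [HirschDT1976]
* Th. Bröcker, K. Jänich, *Introduction to Differential Topology*, CUP (1982), (13.3), (13.8).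
  [BrockerJanich1982]
* J. Milnor, *Lectures on the h-cobordism theorem*, Princeton (1965), §1, Thm. 1.4.
  [MilnorHCobordism1965]
-/

open scoped Manifold ContDiff Topology
open Set Function

noncomputable section

namespace Literature.Topology.FourManifolds

universe u

/-- **Seam tube of an interior seam in a manifold with boundary.**  Let `j₁ : Q₁ → V`,
`j₂ : Q₂ → V` be smooth embeddings of `(n+1)`-manifolds with boundary into the `(n+1)`-manifold
with boundary `V` (Hausdorff, second countable), with values in the interior, covering the
interior, and meeting exactly along `∂Q₁ ≡_φ ∂Q₂` (boundary data `b₁`, `b₂` with `∂Q₁` compact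
and nonempty).  Then there are a jointly `C^∞` map `K : ∂Q₁ × ℝ → V`, an open set `T ⊆ V`, a map
`Kinv : V → ∂Q₁ × ℝ` which is `C^∞` on `T`, and `ε > 0`, such that `K (z, 0) = j₁ (incl z)`,
`K` maps `∂Q₁ × (-ε, ε)` into `T` with `Kinv ∘ K = id` there, `Kinv` maps `T` into
`∂Q₁ × (-ε, ε)` with `K ∘ Kinv = id` there, and for `|t| < ε`: `K (z, t) ∈ range j₁ ↔ 0 ≤ t`
and `K (z, t) ∈ range j₂ ↔ t ≤ 0`.  (The seam tube of the gluing datum formed by the lifts of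
`j₁`, `j₂` into the interior manifold `V°`, `nonempty_seamTube_of_sigmaCompact`, pushed down
along `val`.) [cite: HirschDT1976, Ch. 8 §1, proof of Thm. 1.9] -/
theorem exists_interior_seam_tube {n : ℕ} {V : Type u} [TopologicalSpace V] [T2Space V]
    [SecondCountableTopology V] [ChartedSpace (EuclideanHalfSpace (n + 1)) V]
    [IsManifold (𝓡∂ (n + 1)) ∞ V]
    {Q₁ Q₂ : Type u} [TopologicalSpace Q₁] [ChartedSpace (EuclideanHalfSpace (n + 1)) Q₁]
    [IsManifold (𝓡∂ (n + 1)) ∞ Q₁] [TopologicalSpace Q₂]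
    [ChartedSpace (EuclideanHalfSpace (n + 1)) Q₂] [IsManifold (𝓡∂ (n + 1)) ∞ Q₂]
    (b₁ : BoundaryData (𝓡∂ (n + 1)) Q₁ (𝓡 n)) (b₂ : BoundaryData (𝓡∂ (n + 1)) Q₂ (𝓡 n))
    [CompactSpace b₁.carrier] [Nonempty b₁.carrier] (φ : b₁.carrier ≃ b₂.carrier)
    {j₁ : Q₁ → V} {j₂ : Q₂ → V}
    (h₁ : Manifold.IsSmoothEmbedding (𝓡∂ (n + 1)) (𝓡∂ (n + 1)) ∞ j₁)
    (h₂ : Manifold.IsSmoothEmbedding (𝓡∂ (n + 1)) (𝓡∂ (n + 1)) ∞ j₂)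
    (hint₁ : ∀ q, (𝓡∂ (n + 1)).IsInteriorPoint (j₁ q))
    (hint₂ : ∀ q, (𝓡∂ (n + 1)).IsInteriorPoint (j₂ q))
    (hcover : ∀ p : V, (𝓡∂ (n + 1)).IsInteriorPoint p → p ∈ range j₁ ∪ range j₂)
    (hseam : ∀ a c, j₁ a = j₂ c ↔ ∃ z, a = b₁.incl z ∧ c = b₂.incl (φ z)) :
    ∃ (K : b₁.carrier × ℝ → V) (Kinv : V → b₁.carrier × ℝ) (T : Set V) (ε : ℝ), 0 < ε ∧
      IsOpen T ∧
      ContMDiff ((𝓡 n).prod 𝓘(ℝ, ℝ)) (𝓡∂ (n + 1)) ∞ K ∧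
      ContMDiffOn (𝓡∂ (n + 1)) ((𝓡 n).prod 𝓘(ℝ, ℝ)) ∞ Kinv T ∧
      (∀ z, K (z, 0) = j₁ (b₁.incl z)) ∧
      (∀ z, ∀ t ∈ Ioo (-ε) ε, K (z, t) ∈ T ∧ Kinv (K (z, t)) = (z, t)) ∧
      (∀ p ∈ T, Kinv p ∈ (univ : Set b₁.carrier) ×ˢ Ioo (-ε) ε ∧ K (Kinv p) = p) ∧
      (∀ z, ∀ t ∈ Ioo (-ε) ε,
        (K (z, t) ∈ range j₁ ↔ 0 ≤ t) ∧ (K (z, t) ∈ range j₂ ↔ t ≤ 0)) := by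
  -- the interior as a manifold without boundary, and its instances
  haveI : LocallyCompactSpace (InteriorManifold (𝓡∂ (n + 1)) V) :=
    ChartedSpace.locallyCompactSpace (EuclideanSpace ℝ (Fin (n + 1))) _
  -- the gluing datum of the lifted pieces
  set jA : Q₁ → InteriorManifold (𝓡∂ (n + 1)) V := InteriorManifold.lift j₁ hint₁ with hjA
  set jB : Q₂ → InteriorManifold (𝓡∂ (n + 1)) V := InteriorManifold.lift j₂ hint₂ with hjB
  have hjAe : Manifold.IsSmoothEmbedding (𝓡∂ (n + 1)) (𝓡 (n + 1)) ∞ jA := h₁.interiorLift hint₁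
  have hjBe : Manifold.IsSmoothEmbedding (𝓡∂ (n + 1)) (𝓡 (n + 1)) ∞ jB := h₂.interiorLift hint₂
  have hunion : range jA ∪ range jB = univ := by
    refine eq_univ_of_forall fun x => ?_
    rcases hcover x.val x.property with ⟨a, ha⟩ | ⟨c, hc⟩
    · exact Or.inl ⟨a, InteriorManifold.ext ha⟩
    · exact Or.inr ⟨c, InteriorManifold.ext hc⟩
  have hrel : ∀ a c, jA a = jB c ↔ ∃ z, a = b₁.incl z ∧ c = b₂.incl (φ z) := by
    intro a c
    rw [← hseam a c, ← InteriorManifold.val_inj]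
    rfl
  let G : BoundaryGluingData b₁ b₂ φ (InteriorManifold (𝓡∂ (n + 1)) V) :=
    { jA := jA
      jB := jB
      isSmoothEmbedding_jA := hjAe
      isSmoothEmbedding_jB := hjBe
      range_union := hunion
      jA_eq_jB_iff := hrel }
  -- its seam tube
  obtain ⟨Tt⟩ := G.nonempty_seamTube_of_sigmaCompact
  set x₀ : InteriorManifold (𝓡∂ (n + 1)) V := Tt.toFun (Classical.arbitrary _, 0) with hx₀
  set K : b₁.carrier × ℝ → V := fun q => (Tt.toFun q).val with hK
  set Kinv : V → b₁.carrier × ℝ := fun p => Tt.invFun (InteriorManifold.toInterior x₀ p)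
    with hKinv
  set T : Set V := InteriorManifold.val '' (Tt.height ⁻¹' Ioo (-Tt.ε) Tt.ε) with hT
  have hTsub : T ⊆ (𝓡∂ (n + 1)).interior V := by
    rintro _ ⟨x, -, rfl⟩
    exact x.property
  -- the two sides in terms of the height
  have hsideA : ∀ p : InteriorManifold (𝓡∂ (n + 1)) V, p ∈ range G.jA ↔ 0 ≤ Tt.height p := by
    intro p
    constructor
    · intro hp
      rcases G.mem_seam_or p with hs | hA | hB
      · exact ((Tt.height_eq_zero_iff p).2 hs).ge
      · exact ((Tt.height_pos_iff p).2 hA).le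
      · exact absurd hp (G.not_mem_range_jA_of_mem_image_interior' hB)
    · intro hp
      rcases G.mem_seam_or p with hs | hA | hB
      · exact G.seam_subset_range_jA hs
      · exact image_subset_range _ _ hA
      · exact absurd ((Tt.height_neg_iff p).2 hB) (not_lt.2 hp)
  have hsideB : ∀ p : InteriorManifold (𝓡∂ (n + 1)) V, p ∈ range G.jB ↔ Tt.height p ≤ 0 := by
    intro p
    constructor
    · intro hp
      rcases G.mem_seam_or p with hs | hA | hB
      · exact ((Tt.height_eq_zero_iff p).2 hs).le
      · exact absurd hp (G.not_mem_range_jB_of_mem_image_interior hA)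
      · exact ((Tt.height_neg_iff p).2 hB).le
    · intro hp
      rcases G.mem_seam_or p with hs | hA | hB
      · exact G.seam_subset_range_jB hs
      · exact absurd ((Tt.height_pos_iff p).2 hA) (not_lt.2 hp)
      · exact image_subset_range _ _ hB
  have hrangeA : ∀ q, K q ∈ range j₁ ↔ Tt.toFun q ∈ range G.jA := by
    intro q
    constructor
    · rintro ⟨a, ha⟩
      exact ⟨a, InteriorManifold.ext ha⟩
    · rintro ⟨a, ha⟩
      exact ⟨a, by rw [hK]; exact congrArg InteriorManifold.val ha⟩
  have hrangeB : ∀ q, K q ∈ range j₂ ↔ Tt.toFun q ∈ range G.jB := by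
    intro q
    constructor
    · rintro ⟨c, hc⟩
      exact ⟨c, InteriorManifold.ext hc⟩
    · rintro ⟨c, hc⟩
      exact ⟨c, by rw [hK]; exact congrArg InteriorManifold.val hc⟩
  refine ⟨K, Kinv, T, Tt.ε, Tt.ε_pos, ?_, ?_, ?_, fun z => ?_, fun z t ht => ?_, fun p hp => ?_,
    fun z t ht => ?_⟩
  · exact InteriorManifold.isOpenMap_val _ Tt.isOpen_tube
  · exact InteriorManifold.contMDiff_val.comp Tt.contMDiff_toFun
  · refine Tt.contMDiffOn_invFun.comp
      ((InteriorManifold.contMDiffOn_toInterior x₀).mono hTsub) ?_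
    rintro _ ⟨x, hx, rfl⟩
    show InteriorManifold.toInterior x₀ x.val ∈ Tt.height ⁻¹' Ioo (-Tt.ε) Tt.ε
    rw [InteriorManifold.toInterior_val]
    exact hx
  · change (Tt.toFun (z, 0)).val = j₁ (b₁.incl z)
    rw [Tt.toFun_zero]
    rfl
  · refine ⟨⟨Tt.toFun (z, t), Tt.toFun_mem_tube z ht, rfl⟩, ?_⟩
    change Tt.invFun (InteriorManifold.toInterior x₀ (Tt.toFun (z, t)).val) = (z, t)
    rw [InteriorManifold.toInterior_val, Tt.invFun_toFun z t ht]
  · obtain ⟨x, hx, rfl⟩ := hp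
    have h1 : Kinv x.val = Tt.invFun x := by
      change Tt.invFun (InteriorManifold.toInterior x₀ x.val) = Tt.invFun x
      rw [InteriorManifold.toInterior_val]
    refine ⟨⟨mem_univ _, ?_⟩, ?_⟩
    · rw [h1, Tt.invFun_snd]; exact hx
    · rw [h1]
      change (Tt.toFun (Tt.invFun x)).val = x.val
      rw [Tt.toFun_invFun x hx]
  · refine ⟨?_, ?_⟩
    · rw [hrangeA, hsideA, Tt.height_toFun z t ht]
    · rw [hrangeB, hsideB, Tt.height_toFun z t ht]

end Literature.Topology.FourManifolds

end
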